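import Literature.NumberTheory.Sieve.GreenTao2008SmoothMajorant
import Literature.NumberTheory.Sieve.LinearEquationsInPrimesSieveTau
import Mathlib.NumberTheory.Primorial
import Mathlib.Analysis.SpecialFunctions.Pow.Real
import HarnessLib

/-!
# The enveloping sieve: the two Goldston–Yıldırım inputs of Prop. 6.4 (Green–Tao 2010, App. D)

Trunk T-SIEVE (`Literature/NumberTheory/Sieve`). Part of the App. D layer of the decomposition
of `Literature.NumberTheory.Sieve.GreenTaoZiegler2012_finiteComplexity`, towards the discharge of
`Literature.NumberTheory.Sieve.GreenTao2010_pseudorandomDomination` (B. Green, T. Tao, *Linear equations in primes*,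
Ann. of Math. 171 (2010), Prop. 6.4, "Domination by a pseudorandom measure", proved in App. D,
pp. 47–48 of arXiv:math/0606088, "Construction of the enveloping sieve").

The printed proof of Prop. 6.4 builds the measure from the truncated divisor sums
`Λ_{χ,R,2}` (`Literature.truncDivisorSum χ R 2`) and verifies the linear forms and correlation
conditions (Defs. 6.2, 6.3) by two applications of the Goldston–Yıldırım estimate Thm. D.3 to
`W`-tricked systems.  This file vendors, as named facts, exactly the two displayed consequences
of Thm. D.3 that the printed proof uses:

* `Literature.NumberTheory.Sieve.GreenTao2010_envelopingSieve_linearForms` — the display (D.8) ("phew"):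
  `(φ(W)/W)^m ∑_{n ∈ K ∩ ℤ^d} ∏_{j ∈ [m]} Λ_{χ,R,2}(ψ_j(Wn + b_{i_j})) = vol_d(K) + o(N^d)`
  for systems no two of whose forms are affinely related, `m, d, ‖Ψ‖_N = O_D(1)`,
  `K ⊆ [-N,N]^d` convex with `Ψ(K) ⊆ [-N,N]^m`;
* `Literature.NumberTheory.Sieve.GreenTao2010_envelopingSieve_correlations` — the correlation display
  `(φ(W)/W)^m ∑_{n ∈ I} ∏_{j ∈ [m]} Λ_{χ,R,2}(W(n + h_j) + b_{i_j}) ≪ N ∑_{1 ≤ j < j' ≤ m} τ(h_j - h_{j'})`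
  with `τ` built from `exp(O(∑_{p > w, p | Wn + b_{i_j} - b_{i_{j'}}} p^{-1/2}))`.

Everything else in the printed proof of Prop. 6.4 (the pointwise bound, the decomposition of
`ν` into its components, the moment bounds for `τ`, the case of coincident shifts) is
elementary: the arithmetic input of the moment bounds for `τ` is in the tree
(`Literature.NumberTheory.Sieve.sum_exp_rough_le`, `LinearEquationsInPrimesSieveTau.lean`), and the remaining steps
(decomposition, unwrapping `ℤ_{N'}` to `ℤ`, the coincident case by crude divisor bounds, the
assembly of Prop. 6.4 from the two facts below) are left to later files of this layer
(`…EnvelopingSieveLinearForms`, `…EnvelopingSieveCorrelations`, `…EnvelopingSieveDomination`),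
as is Thm. D.3 itself (and the derivation of the two displays from it, which uses Lemma 1.3,
`∏_{p ≤ w} β_p = (W/φ(W))^m` (printed with exponent `t`, read `m`) and `c_{χ,2} = ∫₀^∞ |χ'|²`,
Lemma D.2).

The closest relative in the tree is `Literature.NumberTheory.Sieve.GreenTao2008.SmoothLinearFormsEstimate` (Conlon–Fox–Zhao,
Prop. 8.3; proved, `Literature.NumberTheory.Sieve.CFZ.smoothLinearFormsEstimate_holds`): the same Goldston–Yıldırım asymptotic
for `∏_j Λ_{χ,R}(θ_j(x))²` with `θ_j = W ψ_j + 1`, averaged over BOXES of side `≥ R^{10m}`, in the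
relative-error form, for one residue class `1 mod W` and a coefficient bound.  The first fact below
is the Green–Tao form of the same estimate: a convex body `K ⊆ [-N,N]^d` (lattice points of `K`,
absolute error `ε N^d`), a residue `b_j` per form (Green–Tao majorise `Λ'_{b_1,W}, …, Λ'_{b_t,W}`
simultaneously, p. 43), and `w` range-uniform up to `½ log log N`; the second (correlations along
`n + h_j` with `|h_j| ≤ N`) has exceptional primes `p > w` and no CFZ counterpart.  Neither is a
formal consequence of the CFZ statement, which is why they are vendored here as facts.

## Rendering

* As in §5 of the source and the sibling files, "`ψ_j(Wn + b)`" for a form `ψ_j` on `ℤ^d`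
  means the `W`-tricked form `W ψ_j(n) + b` (the display is written for `d = 1`-style
  notation), the cutoff `w` is range-uniform (`w₀ ≤ w ≤ ½ log log N`), `W = primorial w`, and
  the residues are `b ∈ [W]` coprime to `W` (Thm. 5.1).
* The sieve level is `R = N^γ`, "`γ = γ(C,D) > 0` a parameter to be chosen later" (proof of
  Prop. 6.4), "`γ > 0` sufficiently small depending on `t,d,L,χ` and `a`" (Thm. D.3); the
  `o(N^d)` of the displays is, in the printed proof, `O(N^d e^{O(X)} log^{-1/20} R)` plus
  `O(R^{O(1)} N^{d-1})` plus the `o(1)` of `∏_{p > w} β_p = 1 + o(1)` (as `w → ∞`).  We therefore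
  quantify `∃ γ₀, ∀ γ ∈ (0, γ₀], ∀ ε, ∃ w₀ N₀, ∀ N ≥ N₀, ∀ w ∈ [w₀, ½ log log N]` with `R = N^γ`.
* The sieve factor.  The source fixes "a smooth even `χ` supported on `[-1,1]` with `χ(0) = 1`
  and `∫₀¹ |χ'|² = 1`", so that `c_{χ,2} = 1` (Lemma D.2) and the main term of (D.8) is
  `vol_d(K)`; the line before reads "`(φ(W)/W)^m c_{χ,2}^m vol_d(K) ∏_p β_p + o(N^d)`".  Since no
  smooth `χ` has both `χ(0) = 1` and `∫₀¹ |χ'|² = 1` (Cauchy–Schwarz forces `χ(x) = 1 - |x|`), we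
  keep the factor `c_{χ,2}^m = (∫₀^∞ χ'(x)² dx)^m` explicit (the tree's `Literature.NumberTheory.Sieve.GreenTao2008.cChi`,
  the same integral) and drop the
  normalisation (and the evenness, which the derivation does not use); the consumer normalises
  by dividing by `c_{χ,2} > 0`.
* The correlation display.  The printed right-hand side is `N ∑_{1 ≤ j < j' ≤ m} τ(h_j - h_{j'})`
  with `τ(n) := ∑_{1 ≤ j < j' ≤ m} exp(O(∑_{p > w, p | Wn + b_{i_j} - b_{i_{j'}}} p^{-1/2}))` itself a sum
  over all pairs of residues.  What the printed analysis establishes (and what we vendor) is the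
  pair-matched form `C N ∑_{j < j'} exp(C ∑_{p > w, p | W(h_j - h_{j'}) + b_j - b_{j'}} p^{-1/2})`: the
  exceptional primes `p > w` of the system `(W(n + h_j) + b_{i_j})_j` (`Literature.NumberTheory.Sieve.IsExceptionalPrime`,
  `LinearEquationsInPrimesSieveDensities.lean`) are those dividing some
  `W(h_j - h_{j'}) + b_{i_j} - b_{i_{j'}}`, so `∏_{p > w} β_p + e^{O(X)} log^{-1/20} R ≪ exp(O(∑` over the
  union`))` `≤ ∏_{j<j'} exp(O(S_{jj'})) ≤ ∑_{j<j'} exp(O(M S_{jj'}))` (`M = m(m-1)/2` pairs, the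
  step of Green–Tao 2008, Lemma 9.10; this is where `m ≥ 2` is used).  Every printed `τ`-value
  contains the matched term, so this is formally STRONGER than the display as printed, within
  Thm. D.3 as printed; a consumer recovers the printed `τ(h_j - h_{j'})` by summing the matched
  terms over all residue pairs `(b_i, b_{i'})` (as `Literature.tauOne` does in the later files).
  The other deltas against the display, each within Thm. D.3 as printed (which is applied, p. 48,
  to "the system of forms `Ψ = (W(n + h_j) + b_{i_j})_{j=1}^m`", of size `‖Ψ‖_N ≍ mW` — the
  uniformity in `W` is exactly what the display asserts — no two forms rational multiples of one
  another, and the body `I`):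
  (i) no diagonal value `τ(0)` is asserted (the coincident case "no two of the `h_i` are equal …
  crude divisor estimates, setting `τ(0)` to be moderately large" is left to the consumer);
  (ii) the hypothesis is that the pairs `(h_j, b_j)` are distinct, i.e. that the forms
  `W(n + h_j) + b_j` are pairwise distinct, a weakening of the printed "no two of the `h_i` are
  equal" (so a strengthening of the fact);
  (iii) signed shifts `|h_j| ≤ N` and intervals `I = [lo, hi] ⊆ [-N, N]` instead of `h_j ∈ [N]`,
  `I ⊆ [N]` (the derivation is insensitive to signs, and the application to Def. 6.3 unwraps
  shifts in `ℤ_{N'}` to signed integers);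
  (iv) an arbitrary admissible residue `b_j` per position instead of `b_{i_j}` drawn from a fixed
  `t`-tuple (equivalent: take the tuple of all admissible residues).
  The prime sums are written with `Literature.NumberTheory.Sieve.roughPrimeFactors` (`…SieveTau.lean`), so that the fact
  composes syntactically with the moment bound `Literature.NumberTheory.Sieve.sum_exp_rough_le` there.

## References

* B. Green, T. Tao, *Linear equations in primes*, Ann. of Math. (2) 171 (2010), 1753–1850
  (arXiv:math/0606088), App. D: Def. D.1, Lemma D.2, Thm. D.3, and the proof of Prop. 6.4
  ("Construction of the enveloping sieve"), displays (D.8) and the correlation estimate.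
* B. Green, T. Tao, *The primes contain arbitrarily long arithmetic progressions*, Ann. of
  Math. (2) 167 (2008), 481–547, Props. 9.5, 9.6 and Lemma 9.10 (the `W`-explicit ancestors of
  the two displays, for the Goldston–Yıldırım divisor sum `Λ_R`), for comparison.
-/

noncomputable section

open Finset MeasureTheory
open scoped BigOperators ContDiff

namespace Literature.NumberTheory.Sieve

variable {d t : ℕ}

/-- A smooth compactly supported (signed) sieve cutoff: "`χ : ℝ → ℝ` is a smooth, compactly
supported function" (Thm. D.3), "supported on `[-1,1]`" (proof of Prop. 6.4).  This is the class
of Thm. D.3, more general than the tree's `Literature.NumberTheory.Sieve.GreenTao2008.IsSmoothCutoff` (CFZ Prop. 8.3: in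
addition `[0,1]`-valued, `IsSmoothCompactCutoff.of_greenTao2008`); Green–Tao need signed cutoffs
such as `χ♯` (App. D, "The correlation estimate for `Λ♯`").  The sieve factor `c_{χ,2} = ∫₀^∞ |χ'|²`
(Lemma D.2) is the tree's `Literature.NumberTheory.Sieve.GreenTao2008.cChi`.
[cite: GreenTao2010, Thm. D.3 and App. D (proof of Prop. 6.4)] -/
def IsSmoothCompactCutoff (χ : ℝ → ℝ) : Prop :=
  ContDiff ℝ ∞ χ ∧ Function.support χ ⊆ Set.Icc (-1 : ℝ) 1

open Classical in
/-- **The linear forms estimate for the enveloping sieve** (Green–Tao 2010, App. D, proof of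
Prop. 6.4, display (D.8), as printed: "we thus reduce to showing that
`(φ(W)/W)^m ∑_{n ∈ K ∩ ℤ^d} ∏_{j ∈ [m]} Λ_{χ,R,2}(ψ_j(Wn + b_{i_j})) = vol_d(K) + o(N^d)` for all
`i₁, …, i_m ∈ [t]`", where "`Ψ = (ψ₁,…,ψ_m)` is a system of affine-linear forms, no two of
which are affinely related, `m, d, ‖Ψ‖_N` are all `O_D(1)`, and `K ⊆ [-N,N]^d` is a convex
body with `Ψ(K) ⊆ [-N,N]^m`"; derived there from Thm. D.3: "the left-hand side of (D.8) [is]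
`(φ(W)/W)^m c_{χ,2}^m vol_d(K) ∏_p β_p + o(N^d)`", `∏_{p ≤ w} β_p = (W/φ(W))^m`,
`∏_{p > w} β_p = 1 + o(1)`; printed with exponent `t`, read `m`).  Rendered (module docstring)
with the sieve factor `c_{χ,2} = ∫₀^∞ χ'²` explicit (`Literature.NumberTheory.Sieve.GreenTao2008.cChi`), `R = N^γ` for `0 < γ ≤ γ₀`, the cutoff `w` range-uniform, residues
`b_j ∈ [W]` coprime to `W = ∏_{p ≤ w} p`, and `ψ_j(Wn + b)` read as `W ψ_j(n) + b`; the
constants depend on `D`, `L`, `χ` (and `N₀` also on `γ`, `ε`). [cite: GreenTao2010, App. D (proof of Prop. 6.4,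
display (D.8)) and Thm. D.3, Lemma D.2] [cite: GreenTaoAnnals2008, Prop. 9.5] -/
def GreenTao2010_envelopingSieve_linearForms : Prop :=
  ∀ (D L : ℕ) (χ : ℝ → ℝ), IsSmoothCompactCutoff χ →
    ∃ γ₀ : ℝ, 0 < γ₀ ∧ ∀ γ : ℝ, 0 < γ → γ ≤ γ₀ → ∀ ε : ℝ, 0 < ε → ∃ w₀ N₀ : ℕ,
      ∀ N : ℕ, N₀ ≤ N → ∀ w : ℕ, w₀ ≤ w → (w : ℝ) ≤ Real.log (Real.log N) / 2 →
      ∀ (d m : ℕ), 1 ≤ d → d ≤ D → 1 ≤ m → m ≤ D →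
      ∀ b : Fin m → ℕ, (∀ j, 1 ≤ b j ∧ b j ≤ primorial w ∧ Nat.Coprime (b j) (primorial w)) →
      ∀ Ψ : Fin m → AffLinForm d, IsNondegenerateSystem Ψ → IsFiniteComplexitySystem Ψ →
        affLinSize Ψ N ≤ L →
      ∀ K : Set (Fin d → ℝ), Convex ℝ K → K ⊆ realBox d N →
        (∀ x ∈ K, ∀ j, |(Ψ j).realEval x| ≤ N) →
        |((Nat.totient (primorial w) : ℝ) / primorial w) ^ m *
            ∑ n ∈ (latticeBox d N).filter (fun n => realPoint n ∈ K),
              ∏ j, truncDivisorSum χ ((N : ℝ) ^ γ) 2 ((primorial w : ℤ) * (Ψ j).eval n + b j) -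
          GreenTao2008.cChi χ ^ m * (volume K).toReal| ≤ ε * (N : ℝ) ^ d

/-- **The correlation estimate for the enveloping sieve** (Green–Tao 2010, App. D, proof of
Prop. 6.4, as printed: "we split up `ν̃` and reduce to showing that
`(φ(W)/W)^m (∑_{n ∈ I} ∏_{j ∈ [m]} Λ_{χ,R,2}(W(n+h_j) + b_{i_j})) ≪ N ∑_{1 ≤ j < j' ≤ m} τ(h_j - h_{j'})`
whenever `i₁, …, i_m ∈ [t]`", "for all `m = O_D(1)`, all `h₁, …, h_m ∈ [N]`, and all intervals
`I ⊆ [N]`", "We may assume that no two of the `h_i` are equal", and, after applying Thm. D.3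
to the forms `W(n + h_j) + b_{i_j}`: "if we set
`τ(n) := ∑_{1 ≤ j < j' ≤ m} exp(O(∑_{p > w, p | Wn + b_{i_j} - b_{i_{j'}}} p^{-1/2}))` then we
obtain the desired correlation estimate").  Rendered (module docstring) with an explicit
constant `C` (depending on `m`, `χ` and `γ`) in place of both `≪` and `O(·)`, `R = N^γ` for
`0 < γ ≤ γ₀`, range-uniform `w`, shifts `|h_j| ≤ N` and intervals `I = [lo, hi] ⊆ [-N, N]`, the forms
`W(n + h_j) + b_j` pairwise distinct, and the PAIR-MATCHED right-hand side
`C N ∑_{j<j'} exp(C ∑_{p > w, p | W(h_j - h_{j'}) + b_j - b_{j'}} p^{-1/2})` that the printed analysis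
yields (formally stronger than the display with the printed `τ`, which sums these terms over
all residue pairs; see the module docstring for this and the other deltas, all within
Thm. D.3 as printed); the inner sum is over the primes `p > w` dividing the non-zero integer
`W(h_j - h_{j'}) + b_j - b_{j'}` (`Literature.NumberTheory.Sieve.roughPrimeFactors`). [cite: GreenTao2010, App. D (proof of
Prop. 6.4, verification of the correlation condition) and Thm. D.3]
[cite: GreenTaoAnnals2008, Prop. 9.6 and Lemma 9.10] -/
def GreenTao2010_envelopingSieve_correlations : Prop :=
  ∀ (m : ℕ) (χ : ℝ → ℝ), 2 ≤ m → IsSmoothCompactCutoff χ →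
    ∃ γ₀ : ℝ, 0 < γ₀ ∧ ∀ γ : ℝ, 0 < γ → γ ≤ γ₀ → ∃ C : ℝ, 0 < C ∧ ∃ w₀ N₀ : ℕ,
      ∀ N : ℕ, N₀ ≤ N → ∀ w : ℕ, w₀ ≤ w → (w : ℝ) ≤ Real.log (Real.log N) / 2 →
      ∀ b : Fin m → ℕ, (∀ j, 1 ≤ b j ∧ b j ≤ primorial w ∧ Nat.Coprime (b j) (primorial w)) →
      ∀ h : Fin m → ℤ, (∀ j, |h j| ≤ N) → (∀ j j', j ≠ j' → (h j, b j) ≠ (h j', b j')) →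
      ∀ lo hi : ℤ, -(N : ℤ) ≤ lo → hi ≤ N →
        ((Nat.totient (primorial w) : ℝ) / primorial w) ^ m *
            ∑ n ∈ Finset.Icc lo hi,
              ∏ j, truncDivisorSum χ ((N : ℝ) ^ γ) 2 ((primorial w : ℤ) * (n + h j) + b j) ≤
          C * N * ∑ j : Fin m, ∑ j' : Fin m,
            if j < j' then
              Real.exp (C * ∑ p ∈ roughPrimeFactors w
                (Int.natAbs ((primorial w : ℤ) * (h j - h j') + b j - b j')), (p : ℝ) ^ (-(1 / 2 : ℝ)))
            else 0

/-! ### Elementary API -/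

/-- A smooth compact cutoff is smooth. [folklore] -/
theorem IsSmoothCompactCutoff.contDiff {χ : ℝ → ℝ} (h : IsSmoothCompactCutoff χ) : ContDiff ℝ ∞ χ := h.1

/-- A smooth compact cutoff vanishes off `[-1, 1]`. [folklore] -/
theorem IsSmoothCompactCutoff.eq_zero {χ : ℝ → ℝ} (h : IsSmoothCompactCutoff χ) {x : ℝ}
    (hx : x ∉ Set.Icc (-1 : ℝ) 1) : χ x = 0 :=
  Function.notMem_support.mp fun hx' => hx (h.2 hx')

/-- A smooth compact cutoff vanishes for `|x| ≥ 1` (at `x = ±1` by continuity): the form of the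
support hypothesis used by the `Literature.CFZ` files. [folklore] -/
theorem IsSmoothCompactCutoff.eq_zero_of_one_le_abs {χ : ℝ → ℝ} (h : IsSmoothCompactCutoff χ) (x : ℝ)
    (hx : 1 ≤ |x|) : χ x = 0 := by
  rcases hx.lt_or_eq with hlt | heq
  · refine h.eq_zero fun hmem => ?_
    rw [Set.mem_Icc] at hmem
    have : |x| ≤ 1 := abs_le.2 ⟨hmem.1, hmem.2⟩
    linarith
  · -- `|x| = 1`: `χ x` is a limit of the values `χ y = 0`, `|y| > 1`
    have hcont : ContinuousAt χ x := h.contDiff.continuous.continuousAt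
    have hzero : ∀ y : ℝ, 1 < |y| → χ y = 0 := fun y hy =>
      h.eq_zero fun hmem => by
        rw [Set.mem_Icc] at hmem
        have : |y| ≤ 1 := abs_le.2 ⟨hmem.1, hmem.2⟩
        linarith
    -- approach `x` along `y_n = x (1 + 1/(n+1))`
    have hx0 : x ≠ 0 := fun h0 => by rw [h0, abs_zero] at heq; exact one_ne_zero heq
    set y : ℕ → ℝ := fun n => x * (1 + 1 / ((n : ℝ) + 1)) with hy
    have hylim : Filter.Tendsto y Filter.atTop (nhds x) := by
      have h1 : Filter.Tendsto (fun n : ℕ => (1 : ℝ) / ((n : ℝ) + 1)) Filter.atTop (nhds 0) :=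
        tendsto_one_div_add_atTop_nhds_zero_nat
      have h2 := (h1.const_add 1).const_mul x
      rw [add_zero, mul_one] at h2
      exact h2
    have hyval : ∀ n, χ (y n) = 0 := fun n => hzero _ (by
      simp only [hy]
      rw [abs_mul, ← heq, one_mul, abs_of_pos (by positivity)]
      have : (0 : ℝ) < 1 / ((n : ℝ) + 1) := by positivity
      linarith)
    have hlim := hcont.tendsto.comp hylim
    have hconst : Filter.Tendsto (fun n => χ (y n)) Filter.atTop (nhds 0) := by
      simp_rw [hyval]; exact tendsto_const_nhds
    exact tendsto_nhds_unique hlim hconst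

/-- The CFZ cutoffs (`[0,1]`-valued in addition) are smooth compact cutoffs. [folklore] -/
theorem IsSmoothCompactCutoff.of_greenTao2008 {χ : ℝ → ℝ} (h : GreenTao2008.IsSmoothCutoff χ) :
    IsSmoothCompactCutoff χ := by
  refine ⟨h.smooth, fun x hx => ?_⟩
  rw [Function.mem_support] at hx
  rw [Set.mem_Icc]
  by_contra hn
  have h1 : 1 ≤ |x| := by
    rw [not_and_or, not_le, not_le] at hn
    rcases hn with h' | h'
    · rw [abs_of_neg (by linarith)]; linarith
    · rw [abs_of_pos (by linarith)]; linarith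
  exact hx (h.eq_zero x h1)

/-- Non-vacuity: the standard bump of `GreenTao2008SmoothMajorant` is a smooth compact cutoff with
`c_{χ,2} > 0` (and `χ(0) = 1`). [folklore] -/
theorem isSmoothCompactCutoff_stdBump :
    IsSmoothCompactCutoff GreenTao2008.stdBump ∧ (GreenTao2008.stdBump : ℝ → ℝ) 0 = 1 ∧
      0 < GreenTao2008.cChi GreenTao2008.stdBump :=
  ⟨IsSmoothCompactCutoff.of_greenTao2008 GreenTao2008.isSmoothCutoff_stdBump.1,
    GreenTao2008.isSmoothCutoff_stdBump.2, GreenTao2008.cChi_stdBump_pos⟩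

end Literature.NumberTheory.Sieve

end
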